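import Literature.AlgebraicGeometry.Frobenioids.DivisorMonoidCategoryTheoreticityCorProofsVI
import Literature.AlgebraicGeometry.Frobenioids.UnitTrivialisationRigidity
import HarnessLib

/-!
# Frobenioids I, Corollary 4.11 (i) — INSTANCE for Frobenioids over Div-slim bases (no rigidity input)

Mochizuki, *The geometry of Frobenioids I: the general theory*, Kyushu J. Math. **62** (2008)
293–400, kurims text Cor. 4.11 (i) p. 91 and its proof pp. 92–93 [cite: MochizukiFrdI2008, Cor. 4.11 (i) p.91].

PROOF-ONLY. Combines `cor411i_restrict_of_rigid` (`DivisorMonoidCategoryTheoreticityCorProofsVI.lean`: the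
`1`-unique `Ψ^un-tr` for THE restriction `Ψ^istr` of `Ψ` to the isotropic objects, from "`Ψ`, `Ψ⁻¹`
preserve `O^×(-)`", seat abc-iut-L1-t10's `EquivalenceUnitsDivSlim`) with the rigidity of
`C₂^istr → C₂^un-tr` (`UnitTrivialisationRigidity.lean`): the typed Cor. 4.11 (i)
(`PreFrobenioidData.Cor411i`, seat abc-iut-L1-t3) for Frobenioids over Div-slim bases, conditional only on
the typed preservation clauses of Thm. 3.4 (i) (isotropic objects), Thm. 3.4 (iii) (pull-back morphisms)
and Thm. 4.2 (i) (Div-identity endomorphisms) for `Ψ` and `Ψ⁻¹`.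

* `cor411i_restrict`: the statement.

No statement of the paper is strengthened; nothing here is specific to the abc programme.
-/

namespace Literature.AlgebraicGeometry.Frobenioids

open CategoryTheory Opposite

universe w v v' u u'

namespace PreFrobenioid

variable {D₁ : Type u} [Category.{v} D₁] {Φ₁ : D₁ᵒᵖ ⥤ CommMonCat.{w}}
  {C₁ : Type u'} [Category.{v'} C₁] (F₁ : C₁ ⥤ ElemFrobenioid Φ₁)
  {D₂ : Type u} [Category.{v} D₂] {Φ₂ : D₂ᵒᵖ ⥤ CommMonCat.{w}}
  {C₂ : Type u'} [Category.{v'} C₂] (F₂ : C₂ ⥤ ElemFrobenioid Φ₂)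
  (Ψ : C₁ ≌ C₂)

/-- **Corollary 4.11 (i) for Frobenioids over Div-slim bases** (FrdI p. 91; proof pp. 92–93): if `Ψ` preserves
isotropic objects (Thm. 3.4 (i)) and `Ψ`, `Ψ⁻¹` preserve pull-back morphisms (Thm. 3.4 (iii)) and Div-identity
endomorphisms (Thm. 4.2 (i)), then for THE restriction `Ψ^istr : C₁^istr ⥲ C₂^istr` of `Ψ` there is a
`1`-unique `Ψ^un-tr : C₁^un-tr ⥲ C₂^un-tr` `1`-commuting with the projections, and both composite functors are
rigid — the typed Cor. 4.11 (i), with no further input. [cite: MochizukiFrdI2008, Cor. 4.11 (i) p.91] -/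
theorem cor411i_restrict (hF₁ : IsFrobenioid F₁) (hF₂ : IsFrobenioid F₂)
    (hiso : ∀ A : C₁, (PreFrobenioidData.ofFunctor Φ₂ F₂).IsIsotropic (Ψ.functor.obj A) ↔
      (PreFrobenioidData.ofFunctor Φ₁ F₁).IsIsotropic A)
    (hds₁ : (PreFrobenioidData.ofFunctor Φ₁ F₁).IsDivSlim) (hds₂ : (PreFrobenioidData.ofFunctor Φ₂ F₂).IsDivSlim)
    (hpb : PreFrobenioidData.PreservesMor Ψ.functor (PreFrobenioidData.ofFunctor Φ₁ F₁).IsPullbackMorphism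
      (PreFrobenioidData.ofFunctor Φ₂ F₂).IsPullbackMorphism)
    (hpb' : PreFrobenioidData.PreservesMor Ψ.inverse (PreFrobenioidData.ofFunctor Φ₂ F₂).IsPullbackMorphism
      (PreFrobenioidData.ofFunctor Φ₁ F₁).IsPullbackMorphism)
    (hdi : ∀ (A : C₁) (φ : A ⟶ A), (PreFrobenioidData.ofFunctor Φ₁ F₁).IsDivIdentity φ →
      (PreFrobenioidData.ofFunctor Φ₂ F₂).IsDivIdentity (Ψ.functor.map φ))
    (hdi' : ∀ (B : C₂) (φ : B ⟶ B), (PreFrobenioidData.ofFunctor Φ₂ F₂).IsDivIdentity φ →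
      (PreFrobenioidData.ofFunctor Φ₁ F₁).IsDivIdentity (Ψ.inverse.map φ)) :
    ∃ Ψistr : (PreFrobenioidData.ofFunctor Φ₁ F₁).Istr ≌ (PreFrobenioidData.ofFunctor Φ₂ F₂).Istr,
      Ψistr.functor ⋙ (PreFrobenioidData.ofFunctor Φ₂ F₂).istrι =
          (PreFrobenioidData.ofFunctor Φ₁ F₁).istrι ⋙ Ψ.functor ∧
        (PreFrobenioidData.ofFunctor Φ₁ F₁).Cor411i (PreFrobenioidData.ofFunctor Φ₂ F₂) Ψ Ψistr.functor := by
  obtain ⟨Ψi, h₁, -, h₃⟩ :=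
    cor411i_restrict_of_rigid F₁ F₂ Ψ hF₁ hF₂ hiso hds₁ hds₂ hpb hpb' hdi hdi'
  exact ⟨Ψi, h₁, h₃ (isRigidFunctor_comp_toUntr hF₂ hds₂ Ψi.functor)⟩

end PreFrobenioid

end Literature.AlgebraicGeometry.Frobenioids
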